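import Summits.QuantumAdvantage.QuantumAdvantage.Theorems.NearExactIsExact.Negative.CornerFlatRankFourIsotropic
import Summits.QuantumAdvantage.QuantumAdvantage.Theorems.NearExactIsExact.Negative.RMDual

/-!
# Corner-flat pairs of rank 4, IV-d: the isotropy lemma in degree language

Negative-side (disprover lane, unit `b2b-cforr-disprove-g33`, 2026-08-23) restatement of
`cfq_window_cube_sections_even_of_cubic` (`Negative/CornerFlatRankFourIsotropic.lean`) for the crux
`CubicForrelation.NearExactIsExact`, in the tree's own `IsDegLeFun` language, through a reusable MÖBIUS CRITERION:

* `cfq_isDegLeFun_of_moebius` — a Boolean function on `𝔽₂^r` whose sub-cube sums `Σ_{J ⊆ S} [F(1_J)]` vanish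
  for all `|S| > d` has degree `≤ d` (its algebraic normal form is `Σ_{|S| ≤ d} m_S x_S`, Möbius inversion in
  characteristic `2`, `sum_powerset_sum_powerset`); with the converse `cfq_moebius_of_isDegLeFun` this is the
  Reed–Muller characterisation `IsDegLeFun d F ↔ ∀ |S| > d, Σ_{J ⊆ S} [F(1_J)] = 0` (`cfq_isDegLeFun_iff_moebius`;
  the ANF-coefficient form of the duality in `Negative/RMDual.lean`, whose `isDegLeFun_of_orthogonal` is phrased
  through parities against all test functions of complementary degree instead).
* `cfq_window_fibre_quadratic_of_cubic` — **in a window pair (`Φ > 15/16`) of the cubic rank-4 corner-flat habitat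
  the dual `h` pulled back to ANY fibre, `y ↦ h(corner(x₁, y))` on `𝔽₂⁴`, has degree `≤ 2`**: the cubic form of
  `h` vanishes on every fibre space — the isotropy lemma, frame-free, as an `IsDegLeFun 2` statement.

HONEST FRAMING: theorems about one habitat of the crux (value = theorem), NOT summit progress.  Standard three
axioms only.
-/

set_option linter.dupNamespace false -- D-0017: single-problem summit ⇒ `QuantumAdvantage.QuantumAdvantage` by design

noncomputable section

namespace Summit.QuantumAdvantage.QuantumAdvantage.Theorems.NearExactIsExact.Negative.CornerFlatRankFour

open Finset
open Literature.Computability.QuantumComplexity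
open Summit.QuantumAdvantage.QuantumAdvantage.Theorems.NearExactIsExact.Negative.SkewProductCore (ind ind_and ind_xor
  ind_true ind_false decide_ind_eq_one ind_decide_eq_one indic supp indic_supp prod_ind_eq sum_powerset_sum_powerset
  sum_powerset_supp)
open Summit.QuantumAdvantage.QuantumAdvantage.Theorems.NearExactIsExact.Negative.CornerFlatPluecker (cfp_eval_ind)
open Summit.QuantumAdvantage.QuantumAdvantage.Theorems.NearExactIsExact.Negative.RMDual (supp_indic)

variable {a r : ℕ}

section Moebius

/-! ### A Möbius criterion for `IsDegLeFun` -/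

/-- Sub-cube sums as sums over indicator vectors: `Σ_{J ⊆ S} G(1_J) = Σ_{y : supp y ⊆ S} G(y)`. [folklore] -/
theorem cfq_sum_powerset_indic (S : Finset (Fin r)) (G : (Fin r → Bool) → ZMod 2) :
    ∑ J ∈ S.powerset, G (indic J) = ∑ y ∈ univ.filter (fun y : Fin r → Bool => supp y ⊆ S), G y := by
  refine sum_nbij' indic supp (fun J hJ => ?_) (fun y hy => ?_) (fun J _ => supp_indic J)
    (fun y _ => indic_supp y) fun J _ => rfl
  · rw [mem_filter, supp_indic]
    exact ⟨mem_univ _, mem_powerset.mp hJ⟩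
  · exact mem_powerset.mpr (mem_filter.mp hy).2

/-- **Möbius criterion.**  If the sub-cube sums `Σ_{J ⊆ S} [F(1_J)]` vanish in `𝔽₂` for every `S` with
`|S| > d`, then `F` has degree `≤ d`: by Möbius inversion `[F(y)] = Σ_{S ⊆ supp y} m_S` with
`m_S = Σ_{J ⊆ S} [F(1_J)]`, so the algebraic normal form `Σ_{|S| ≤ d} m_S x_S` represents `F`. [folklore] -/
theorem cfq_isDegLeFun_of_moebius {d : ℕ} (F : (Fin r → Bool) → Bool)
    (hz : ∀ S : Finset (Fin r), d < S.card → (∑ J ∈ S.powerset, ind (F (indic J))) = 0) :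
    IsDegLeFun d F := by
  classical
  let mo : Finset (Fin r) → ZMod 2 := fun S => ∑ J ∈ S.powerset, ind (F (indic J))
  let p : MvPolynomial (Fin r) (ZMod 2) :=
    ∑ S ∈ univ.filter (fun S : Finset (Fin r) => S.card ≤ d), MvPolynomial.C (mo S) * ∏ k ∈ S, MvPolynomial.X k
  have hmo : ∀ w : Fin r → Bool, ind (F w) =
      ∑ S ∈ univ.filter (fun S : Finset (Fin r) => S.card ≤ d), (∏ k ∈ S, ind (w k)) * mo S := by
    intro w
    have h1 : ind (F w) = ∑ S ∈ (supp w).powerset, mo S := by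
      have key := sum_powerset_sum_powerset (fun J => ind (F (indic J))) (supp w)
      rw [indic_supp] at key
      exact key.symm
    rw [h1, sum_powerset_supp, ← sum_filter_add_sum_filter_not univ (fun S : Finset (Fin r) => S.card ≤ d)]
    have h0 : ∑ S ∈ univ.filter (fun S : Finset (Fin r) => ¬S.card ≤ d), (∏ k ∈ S, ind (w k)) * mo S = 0 :=
      sum_eq_zero fun S hS => by
        have hS0 : mo S = 0 := hz S (not_le.mp (mem_filter.mp hS).2)
        rw [hS0, mul_zero]
    rw [h0, add_zero]
  have heval : ∀ w : Fin r → Bool, MvPolynomial.eval (fun j => if w j then (1 : ZMod 2) else 0) p =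
      ∑ S ∈ univ.filter (fun S : Finset (Fin r) => S.card ≤ d), (∏ k ∈ S, ind (w k)) * mo S := by
    intro w
    simp only [p, map_sum, map_mul, MvPolynomial.eval_C, map_prod, MvPolynomial.eval_X]
    exact sum_congr rfl fun S _ => mul_comm _ _
  refine ⟨p, ?_, fun w => ?_⟩
  · refine MvPolynomial.totalDegree_finsetSum_le fun S hS => ?_
    have hSd : S.card ≤ d := (mem_filter.mp hS).2
    have hprod : (∏ k ∈ S, (MvPolynomial.X k : MvPolynomial (Fin r) (ZMod 2))).totalDegree ≤ S.card := by
      refine (MvPolynomial.totalDegree_finsetProd _ _).trans ?_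
      rw [card_eq_sum_ones]
      exact sum_le_sum fun k _ => by rw [MvPolynomial.totalDegree_X]
    have hC : (MvPolynomial.C (mo S) : MvPolynomial (Fin r) (ZMod 2)).totalDegree = 0 :=
      MvPolynomial.totalDegree_C _
    have hmul := MvPolynomial.totalDegree_mul (MvPolynomial.C (mo S)) (∏ k ∈ S, (MvPolynomial.X k :
      MvPolynomial (Fin r) (ZMod 2)))
    omega
  · rw [polyPhase_apply, heval, ← hmo, decide_ind_eq_one]

/-- Supersets of `M` inside `S` come in pairs when `|M| < |S|`: `#{J : M ⊆ J ⊆ S}` is even. [folklore] -/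
theorem cfq_superset_count_even (S M : Finset (Fin r)) (hMS : M.card < S.card) :
    (∑ J ∈ S.powerset, (if M ⊆ J then (1 : ZMod 2) else 0)) = 0 := by
  classical
  by_cases hsub : M ⊆ S
  · obtain ⟨i₁, hi₁S, hi₁M⟩ : ∃ i₁ ∈ S, i₁ ∉ M := by
      by_contra hno
      push Not at hno
      exact absurd (card_le_card fun i hi => hno i hi) (not_le.mpr hMS)
    rw [← insert_erase hi₁S, sum_powerset_insert (notMem_erase i₁ S)]
    have e2 : ∀ J ∈ (S.erase i₁).powerset,
        (if M ⊆ insert i₁ J then (1 : ZMod 2) else 0) = if M ⊆ J then 1 else 0 := fun J _ => by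
      by_cases hMJ : M ⊆ J
      · rw [if_pos hMJ, if_pos ((subset_insert_iff_of_notMem hi₁M).mpr hMJ)]
      · rw [if_neg hMJ, if_neg fun h' => hMJ ((subset_insert_iff_of_notMem hi₁M).mp h')]
    rw [sum_congr rfl e2, CharTwo.add_self_eq_zero]
  · refine sum_eq_zero fun J hJ => ?_
    rw [if_neg fun hMJ => hsub (hMJ.trans (mem_powerset.mp hJ))]

/-- **Converse of the Möbius criterion**: a function of degree `≤ d` has vanishing sub-cube sums
`Σ_{J ⊆ S} [F(1_J)] = 0` for all `|S| > d` (each monomial `x_M`, `|M| ≤ d`, is counted on the even number of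
`J` with `M ⊆ J ⊆ S`). [folklore] -/
theorem cfq_moebius_of_isDegLeFun {d : ℕ} {F : (Fin r → Bool) → Bool} (hF : IsDegLeFun d F)
    (S : Finset (Fin r)) (hS : d < S.card) : (∑ J ∈ S.powerset, ind (F (indic J))) = 0 := by
  classical
  obtain ⟨p, hp, hrep⟩ := hF
  have hev : ∀ J : Finset (Fin r), ind (F (indic J)) =
      ∑ m ∈ p.support, p.coeff m * (if m.support ⊆ J then 1 else 0) := by
    intro J
    rw [hrep, polyPhase_apply, ind_decide_eq_one, cfp_eval_ind]
    refine sum_congr rfl fun m _ => ?_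
    rw [prod_ind_eq (indic J) m.support, supp_indic]
  calc (∑ J ∈ S.powerset, ind (F (indic J)))
      = ∑ J ∈ S.powerset, ∑ m ∈ p.support, p.coeff m * (if m.support ⊆ J then 1 else 0) :=
        sum_congr rfl fun J _ => hev J
    _ = ∑ m ∈ p.support, p.coeff m * ∑ J ∈ S.powerset, (if m.support ⊆ J then (1 : ZMod 2) else 0) := by
        rw [sum_comm]
        simp only [← mul_sum]
    _ = 0 := sum_eq_zero fun m hm => by
        rw [cfq_superset_count_even S m.support ((cff_card_support_le hp hm).trans_lt hS), mul_zero]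

/-- **Reed–Muller characterisation of degree**: `IsDegLeFun d F ↔` all sub-cube sums over `|S| > d` vanish.
[folklore] -/
theorem cfq_isDegLeFun_iff_moebius {d : ℕ} (F : (Fin r → Bool) → Bool) :
    IsDegLeFun d F ↔ ∀ S : Finset (Fin r), d < S.card → (∑ J ∈ S.powerset, ind (F (indic J))) = 0 :=
  ⟨fun hF S hS => cfq_moebius_of_isDegLeFun hF S hS, cfq_isDegLeFun_of_moebius F⟩

end Moebius

section FibreQuadratic

/-! ### Window pairs: the pulled-back dual is quadratic on every fibre -/

/-- **The isotropy lemma in degree language.**  In the cubic rank-4 corner-flat habitat (`f(x₁‖x₂) =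
l_{u₁}l_{u₂} ⊕ l_{u₃}l_{u₄} ⊕ l_w ⊕ f₀` cubic, `g` bent along `φ` with cubic dual `h`, injective corner maps), a
window pair `Φ(f,g) > 15/16` has, on EVERY fibre `x₁`, a pulled-back dual `y ↦ h(corner(x₁; y₀,y₁,y₂,y₃))` of
degree `≤ 2` on `𝔽₂⁴` — the cubic form of `h` vanishes on `V(x₁)³`: total isotropy, with no frame hypothesis
(`cfq_window_cube_sections_even_of_cubic` + the Möbius criterion). [folklore] -/
theorem cfq_window_fibre_quadratic_of_cubic
    (l : (Fin (a + 4) → Bool) → (Fin (a + 4) → Bool) → Bool) (hl : ∀ y x, signOf (l y x) = twist x y)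
    (u₁ u₂ u₃ u₄ w : (Fin a → Bool) → (Fin (a + 4) → Bool)) (f₀ : (Fin a → Bool) → Bool)
    (φ : (Fin (a + 4) → Bool) → (Fin a → Bool)) (h : (Fin (a + 4) → Bool) → Bool)
    (f g : (Fin (a + (a + 4)) → Bool) → Bool)
    (hf : ∀ x₁ x₂, f (Fin.append x₁ x₂) =
      ((l (u₁ x₁) x₂ && l (u₂ x₁) x₂) ^^ (l (u₃ x₁) x₂ && l (u₄ x₁) x₂) ^^ l (w x₁) x₂ ^^ f₀ x₁))
    (hg : ∀ (y₁ : Fin a → Bool) (y₂ : Fin (a + 4) → Bool),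
      signOf (g (Fin.append y₁ y₂)) = twist y₁ (φ y₂) * signOf (h y₂))
    (corner : (Fin a → Bool) → (Bool × Bool) × (Bool × Bool) → (Fin (a + 4) → Bool))
    (hc : ∀ x₁ q j, corner x₁ q j =
      (w x₁ j ^^ (q.1.1 && u₁ x₁ j) ^^ (q.1.2 && u₂ x₁ j) ^^ (q.2.1 && u₃ x₁ j) ^^ (q.2.2 && u₄ x₁ j)))
    (hφ : ∀ x₁ q, φ (corner x₁ q) = x₁) (hinj : ∀ x₁, Function.Injective (corner x₁))
    (hfc : IsDegLeFun 3 f) (hh : IsDegLeFun 3 h) (hwin : 15 / 16 < forrelation f g) (x₁ : Fin a → Bool) :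
    IsDegLeFun 2 (fun y : Fin 4 → Bool => h (corner x₁ ((y 0, y 1), (y 2, y 3)))) := by
  classical
  -- the reindexing `𝔽₂⁴ ≃ (Bool × Bool) × (Bool × Bool)`
  let e : (Fin 4 → Bool) ≃ (Bool × Bool) × (Bool × Bool) :=
    ⟨fun y => ((y 0, y 1), (y 2, y 3)), fun q => ![q.1.1, q.1.2, q.2.1, q.2.2],
      fun y => by funext i; fin_cases i <;> rfl, fun q => rfl⟩
  have sec := cfq_window_cube_sections_even_of_cubic l hl u₁ u₂ u₃ u₄ w f₀ φ h f g hf hg corner hc hφ hinj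
    hfc hh hwin x₁
  -- (T) the whole fibre is even
  have hT : (∑ y : Fin 4 → Bool, ind (h (corner x₁ (e y)))) = 0 := by
    rw [Fintype.sum_equiv e (fun y => ind (h (corner x₁ (e y)))) (fun q => ind (h (corner x₁ q)))
      fun y => rfl]
    have key := sec false ((false, false), (false, false)) false
    rwa [filter_true_of_mem fun q _ => by simp] at key
  -- (H) every frame half `{y_{i₀} = b}` is even
  have hH : ∀ (i₀ : Fin 4) (b : Bool),
      (∑ y ∈ univ.filter (fun y : Fin 4 → Bool => y i₀ = b), ind (h (corner x₁ (e y)))) = 0 := by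
    intro i₀ b
    have hpred : ∀ y : Fin 4 → Bool, (false ^^ ((e y).1.1 && (e fun i => decide (i = i₀)).1.1) ^^
        ((e y).1.2 && (e fun i => decide (i = i₀)).1.2) ^^ ((e y).2.1 && (e fun i => decide (i = i₀)).2.1) ^^
        ((e y).2.2 && (e fun i => decide (i = i₀)).2.2)) = y i₀ := by
      intro y
      show (false ^^ (y 0 && decide ((0 : Fin 4) = i₀)) ^^ (y 1 && decide ((1 : Fin 4) = i₀)) ^^
        (y 2 && decide ((2 : Fin 4) = i₀)) ^^ (y 3 && decide ((3 : Fin 4) = i₀))) = y i₀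
      fin_cases i₀ <;> simp
    have key := sec false (e fun i => decide (i = i₀)) b
    rw [sum_filter] at key ⊢
    rw [Fintype.sum_equiv e (fun y => if y i₀ = b then ind (h (corner x₁ (e y))) else 0)
      (fun q => if (false ^^ (q.1.1 && (e fun i => decide (i = i₀)).1.1) ^^
        (q.1.2 && (e fun i => decide (i = i₀)).1.2) ^^ (q.2.1 && (e fun i => decide (i = i₀)).2.1) ^^
        (q.2.2 && (e fun i => decide (i = i₀)).2.2)) = b then ind (h (corner x₁ q)) else 0)
      fun y => by rw [hpred y]]
    exact key
  -- Möbius criterion on `𝔽₂⁴` with `d = 2`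
  refine cfq_isDegLeFun_of_moebius _ fun S hS => ?_
  show (∑ J ∈ S.powerset, (fun y : Fin 4 → Bool => ind (h (corner x₁ (e y)))) (indic J)) = 0
  rw [cfq_sum_powerset_indic S (fun y : Fin 4 → Bool => ind (h (corner x₁ (e y))))]
  have hS4 : S.card ≤ 4 := (card_le_univ S).trans (by simp)
  by_cases h4 : S.card = 4
  · have hSu : S = univ := (Finset.card_eq_iff_eq_univ S).mp (by rw [h4]; simp)
    rw [hSu, filter_true_of_mem fun y _ => subset_univ _]
    exact hT
  · have h3 : S.card = 3 := by omega
    obtain ⟨i₀, hi₀⟩ : ∃ i₀, i₀ ∉ S := by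
      by_contra hno
      push Not at hno
      have : S = univ := eq_univ_iff_forall.mpr hno
      rw [this] at h3
      simp at h3
    have hSe : S = univ.erase i₀ := by
      refine eq_of_subset_of_card_le (fun j hj => mem_erase.mpr ⟨fun hji => hi₀ (hji ▸ hj), mem_univ _⟩) ?_
      rw [card_erase_of_mem (mem_univ _), card_univ, h3]
      simp
    have hfl : (univ.filter fun y : Fin 4 → Bool => supp y ⊆ S) = univ.filter fun y => y i₀ = false := by
      refine filter_congr fun y _ => ?_
      rw [hSe, subset_erase]
      simp [supp]
    rw [hfl]
    exact hH i₀ false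

end FibreQuadratic

end Summit.QuantumAdvantage.QuantumAdvantage.Theorems.NearExactIsExact.Negative.CornerFlatRankFour

end
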